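import Summits.Ventures.PercRepro.SixFourPLCovPairs3
import Summits.Ventures.PercRepro.SixFourPLCov3D

/-!
# PercRepro — C-025 at `(6,4)`, step (4) of `PLJlow`: the SEAM `Xcnt M G ≤ X̄(π)` / `≤ X̄′(π)` (mine-2; the seam block of
`Seam.lean` l.1196–1226, bodies verbatim)

The step-(4) chain of record (`MINE2-RLS.md` §21.18.9.2, PRECISION 3) is `Xcnt M G ≤ Σ_{covPairs3} 2^{|P ∩ P′ ∩ G|} ≤
X̄(profile D)` (resp. `≤ X̄′(profile D)` at `g = 8, 9`), cut into gate-sized modules: `SixFourPLCovPairs3` (the first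
inequality, on the rank-3-trace planes; imports the landed `SixFourT4XA`) and `SixFourPLCov3A → SixFourPLCov3B →
SixFourPLCov3C → SixFourPLCov3D` (the second inequality as pure finite-set statements; `SixFourPLCov3A` imports the
landed `SixFourPLList`), joined by `SixFourPLSeam` (`Xcnt_le_Xbar_seam`, `Xcnt_le_Xbar'_seam`). The bodies are those of
lean-drafts/mine-2/SixFourPLCov3.lean (1,012 lines, sha16 54cf6c11e44bf06b) verbatim; only the preambles differ.

This file composes the two inequalities: `covPairs3_eq_covPairsOf` (the §21.18.9.2 identification is definitional),
**`Xcnt_le_Xbar_seam`** (`g = 10..12`: from `hGeq : G = ρ ∪ L`, `hG`, `hr`, `h : PLTraceData π ρ L C N`, `hinj`, `hsub`) and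
**`Xcnt_le_Xbar'_seam`** (`g = 8, 9`: also `h' : PLTraceDataNew π ρ L C N`). The bridge terms `hinj` (`plane_eq_clF_trace`),
`hsub` (`plane_trichotomy` + `Pi_inter_eq`), `h` / `h'` (the `PLData` width facts) are the matroid side (p3). Imports
`SixFourPLCovPairs3` and `SixFourPLCov3D`.
-/

namespace PercRepro.SixFour

open Finset ThmH

variable {α : Type*} [DecidableEq α] {M : Matroid α} [M.Finite] {G : Finset α}

/-- `covPairs3` is `covPairsOf` on the rank-3-trace planes, definitionally. -/
theorem covPairs3_eq_covPairsOf (M : Matroid α) [M.Finite] (G : Finset α) :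
    covPairs3 M G = covPairsOf (planes3 M G) G := rfl

/-- Step (4), g = 10..12 form: `X ≤ X̄(π)` from the bridge hypotheses (p3's matroid side: `hinj`, `hsub`, `h`). -/
theorem Xcnt_le_Xbar_seam {π : PL.CProf} {ρ L : Finset α} {C N : Finset (Finset α)}
    (hGeq : G = ρ ∪ L) (hG : G ⊆ gr M) (hr : M.eRk (G : Set α) = 4)
    (h : PLTraceData π ρ L C N)
    (hinj : Set.InjOn (fun P : Finset α => P ∩ (ρ ∪ L)) (planes3 M G))
    (hsub : ((planes3 M G).image fun P => P ∩ (ρ ∪ L)) ⊆ tracesOf ρ L C N) :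
    Xcnt M G ≤ PL.Xbar π := by
  subst hGeq
  exact (Xcnt_le_sum_covPairs3 hG hr).trans (sum_covPairsOf_le_Xbar_of_subset h hinj hsub)

/-- Step (4), g = 8, 9 form: `X ≤ X̄′(π)`. -/
theorem Xcnt_le_Xbar'_seam {π : PL.CProf} {ρ L : Finset α} {C N : Finset (Finset α)}
    (hGeq : G = ρ ∪ L) (hG : G ⊆ gr M) (hr : M.eRk (G : Set α) = 4)
    (h : PLTraceData π ρ L C N) (h' : PLTraceDataNew π ρ L C N)
    (hinj : Set.InjOn (fun P : Finset α => P ∩ (ρ ∪ L)) (planes3 M G))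
    (hsub : ((planes3 M G).image fun P => P ∩ (ρ ∪ L)) ⊆ tracesOf ρ L C N) :
    Xcnt M G ≤ PL.Xbar' π := by
  subst hGeq
  exact (Xcnt_le_sum_covPairs3 hG hr).trans (sum_covPairsOf_le_Xbar'_of_subset h h' hinj hsub)

end PercRepro.SixFour
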